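import Mathlib.NumberTheory.NumberField.ClassNumber
import Mathlib.LinearAlgebra.FreeModule.IdealQuotient
import Summits.BirchSwinnertonDyer.BirchSwinnertonDyer.Theorems.ResidualThetaTransportAtTwoHeckeThetaPartnerAdicAtTwoMatchingAtTwoPrelim
import HarnessLib

/-!
# The type-`(1,0)` Größencharakter is a `2`-adic unit at the primes away from `2` and its modulus

Route `ResidualThetaTransportAtTwo`, crux K0⁺ `HeckeThetaPartnerAdicAtTwo` (stmt-BirchSwinnertonDyer-20690),
helper §hU of the line "proof from print" (the unit hypothesis `hU` of the Teichmüller twist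
`…TeichmullerTwist.exists_isGrossencharakter_congr` for the Größencharakter `ψ₀` of
`…TypeOneGrossencharakter.exists_isGrossencharakter_embType`).  THEOREMS ONLY (no definition, no named
fact, no `sorry`).

**Main result** `norm_symm_eq_one_of_principal_values`: let `k` be a number field in which `(2)` is
prime, `e : ℚ̄₂ ≃ ℂ`, `σ : k → ℂ`, `𝔣 ≠ 0` an ideal coprime to `(2)`, `λ` a character of `(𝓞_k/𝔣)ˣ` and
`ψ₀` a function on the primes whose values on principal ideals `(b)` prime to `𝔣` are `σ(b) λ(b̄)`.
Then `‖e⁻¹ ψ₀(v)‖ = 1` for every prime `v ≠ (2)`, `v ∤ 𝔣`: `v^h = (π)` is principal for the class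
number `h` (`ClassGroup` is finite), `π` is odd and prime to `𝔣`, so `ψ₀(v)^h = σ(π) λ(π̄)` is a
`2`-adic unit (`norm_symm_embedding_eq_one_of_not_mem`; `λ(π̄)` is a root of unity).

Reference: Neukirch, *Algebraic Number Theory*, VII §6 (Größencharaktere), I §6 (finiteness of the
class number).
-/

set_option autoImplicit false
set_option linter.dupNamespace false

noncomputable section

open scoped NumberField nonZeroDivisors
open NumberField IsDedekindDomain
open Literature.NumberTheory.LFunctions

namespace Summit.BirchSwinnertonDyer.BirchSwinnertonDyer.Theorems.HeckeThetaPartner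

variable {k : Type} [Field k] [NumberField k]

/-- **Every prime of `𝓞_k` has a principal power** `v^h = (π)`, `h ≥ 1` (finiteness of the class
group). [folklore] -/
theorem exists_pow_eq_span_singleton (v : HeightOneSpectrum (𝓞 k)) :
    ∃ (h : ℕ) (π : 𝓞 k), 0 < h ∧ v.asIdeal ^ h = Ideal.span {π} := by
  classical
  have hI : v.asIdeal ^ Fintype.card (ClassGroup (𝓞 k)) ∈ (Ideal (𝓞 k))⁰ :=
    mem_nonZeroDivisors_of_ne_zero (pow_ne_zero _ v.ne_bot)
  have hv : v.asIdeal ∈ (Ideal (𝓞 k))⁰ := mem_nonZeroDivisors_of_ne_zero v.ne_bot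
  have h1 : ClassGroup.mk0 ⟨v.asIdeal ^ Fintype.card (ClassGroup (𝓞 k)), hI⟩ = 1 := by
    have : (⟨v.asIdeal ^ Fintype.card (ClassGroup (𝓞 k)), hI⟩ : (Ideal (𝓞 k))⁰) =
        ⟨v.asIdeal, hv⟩ ^ Fintype.card (ClassGroup (𝓞 k)) := by
      ext; simp
    rw [this, map_pow, pow_card_eq_one]
  obtain ⟨π, hπ⟩ := ((ClassGroup.mk0_eq_one_iff hI).mp h1).principal
  exact ⟨Fintype.card (ClassGroup (𝓞 k)), π, Fintype.card_pos, by rw [hπ]⟩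

/-- Values of a character of the finite group `(𝓞_k/𝔣)ˣ` (`𝔣 ≠ 0`) are roots of unity, hence `2`-adic
units along `e`. [folklore] -/
theorem norm_symm_unitCharacter_eq_one (e : PadicAlgCl 2 ≃+* ℂ) {𝔣 : Ideal (𝓞 k)} (h𝔣 : 𝔣 ≠ ⊥)
    (lam : (𝓞 k ⧸ 𝔣)ˣ →* ℂˣ) (u : (𝓞 k ⧸ 𝔣)ˣ) : ‖e.symm ((lam u : ℂˣ) : ℂ)‖ = 1 := by
  haveI : Finite (𝓞 k ⧸ 𝔣) := Ideal.finiteQuotientOfFreeOfNeBot 𝔣 h𝔣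
  have hfin : IsOfFinOrder u := isOfFinOrder_of_finite u
  have hpow : ((lam u : ℂˣ) : ℂ) ^ orderOf u = 1 := by
    rw [← Units.val_pow_eq_pow_val, ← map_pow, pow_orderOf_eq_one, map_one, Units.val_one]
  exact norm_symm_eq_one_of_pow_eq_one e hfin.orderOf_pos hpow

/-- **`ψ₀` is a `2`-adic unit off `2𝔣`.**  See the module docstring.
[cite: NeukirchANT1999, Ch. VII §6 Def. (6.1)] -/
theorem norm_symm_eq_one_of_principal_values (hp : (Ideal.span {(2 : 𝓞 k)}).IsPrime)
    (e : PadicAlgCl 2 ≃+* ℂ) (σ : k →+* ℂ) {𝔣 : Ideal (𝓞 k)} (h𝔣 : 𝔣 ≠ ⊥)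
    (lam : (𝓞 k ⧸ 𝔣)ˣ →* ℂˣ) {ψ₀ : HeightOneSpectrum (𝓞 k) → ℂ}
    (hval : ∀ (b : 𝓞 k), b ≠ 0 → ∀ hb : IsUnit (Ideal.Quotient.mk 𝔣 b),
      idealPow k ψ₀ (Ideal.span {b}) = σ (b : k) * (lam hb.unit : ℂ))
    (v : HeightOneSpectrum (𝓞 k)) (hv2 : v.asIdeal ≠ Ideal.span {(2 : 𝓞 k)})
    (hv𝔣 : ¬ 𝔣 ≤ v.asIdeal) : ‖e.symm (ψ₀ v)‖ = 1 := by
  classical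
  set P := Ideal.span {(2 : 𝓞 k)} with hPdef
  have hP0 : P ≠ ⊥ := by rw [hPdef, Ne, Ideal.span_singleton_eq_bot]; norm_num
  haveI : P.IsMaximal := hp.isMaximal hP0
  obtain ⟨h, π, hh, hvh⟩ := exists_pow_eq_span_singleton v
  have hvh0 : v.asIdeal ^ h ≠ ⊥ := pow_ne_zero _ v.ne_bot
  have hπ0 : π ≠ 0 := by
    intro h0; apply hvh0; rw [hvh, h0, Ideal.span_singleton_eq_bot]
  -- `π` is odd
  have hπP : π ∉ P := by
    intro hπ
    have hle : v.asIdeal ^ h ≤ P := by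
      rw [hvh, Ideal.span_singleton_le_iff_mem]; exact hπ
    have hvP : v.asIdeal ≤ P := (Ideal.IsPrime.pow_le_iff (I := v.asIdeal) hh.ne').mp hle
    exact hv2 (v.isMaximal.eq_of_le hp.ne_top hvP)
  -- `π` is prime to `𝔣`
  have hπ𝔣 : IsCoprime (Ideal.span {π}) 𝔣 := by
    rw [← hvh]
    refine IsCoprime.pow_left ((isCoprime_iff_forall_not_le h𝔣).mpr fun w hw hvw => hv𝔣 ?_)
    have : v = w := HeightOneSpectrum.ext (v.isMaximal.eq_of_le w.isPrime.ne_top hvw)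
    rwa [this]
  have hunit : IsUnit (Ideal.Quotient.mk 𝔣 π) := isUnit_mk_of_isCoprime hπ𝔣
  -- `ψ₀(v)^h = σ(π) λ(π̄)`
  have hpow : ψ₀ v ^ h = σ (π : k) * (lam hunit.unit : ℂ) := by
    rw [← idealPow_asIdeal ψ₀ v, ← idealPow_pow ψ₀ v.ne_bot, hvh]
    exact hval π hπ0 hunit
  have hnorm : ‖e.symm (ψ₀ v)‖ ^ h = 1 := by
    rw [← norm_pow, ← map_pow, hpow, map_mul, norm_mul, norm_symm_embedding_eq_one_of_not_mem e σ hp hπP,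
      norm_symm_unitCharacter_eq_one e h𝔣 lam, one_mul]
  exact (pow_eq_one_iff_of_nonneg (norm_nonneg _) hh.ne').mp hnorm

end Summit.BirchSwinnertonDyer.BirchSwinnertonDyer.Theorems.HeckeThetaPartner

end
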